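import Summits.NavierStokesRegularity.NavierStokesRegularity.Theorems.CoriolisHeadTypeIRateReduction
import HarnessLib

/-!
# CoriolisHeadTypeIRateLogTransport — crux `NoCoRotatingCore` (stmt-NavierStokesRegularity-22676), line
# `far_field_constancy` v2 (skeleton 15c9a82ad206abb9), stub K1c `stub_typeIRate`:
# spiral transport with CRITICAL forcing (the logarithm), 1/2

The landed transport lemmas (`CoriolisHeadTypeIRateTransport`, `…Reduction`) integrate a SUBCRITICAL forcing
`C/‖y‖^{1+δ}` along the spiral characteristics of `V = ay − By` against the damping `e^{−as} = R/r` and give the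
Type-I rate `‖y‖‖W(y)‖ ≤ const`.  Here the forcing is CRITICAL, `C/‖y‖`: each unit of flow time contributes `C/R`,
so `‖y‖‖W(y)‖ ≤ Rm + D/(aR) + (eC/a)(1 + log(ρ/R))` on the shell `R ≤ ‖y‖ ≤ ρ` (`norm_mul_norm_le_of_transport_log`,
derived from the subcritical lemma by the choice `δ = 1/(1 + log(ρ/R))`, `(ρ/R)^δ ≤ e`), and the shell-maximum
bootstrap absorbs a linear term `κ‖W‖/‖y‖`, `κ ≤ aR/2` (`norm_mul_norm_le_of_transport_linear_log`, `…_shift`).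
Used by `CoriolisHeadTypeIRateLogRate` (K1c up to a logarithm from K1a ∧ U → b).  Elementary; nothing here is
specific to Navier–Stokes, and nothing here proves K1c, `NoCoRotatingCore` or NS regularity.

References: line card `Cruxes/NoCoRotatingCore/Lines/far_field_constancy.md` (K1c block: "the homogeneous
resonance"); B. Pineau, V. Vicol, arXiv:2607.09619 (2026), (1.8) [PineauVicol2026].
-/

noncomputable section

open MeasureTheory Set Function Filter Topology Metric InnerProductSpace Real
open scoped RealInnerProductSpace Laplacian ContDiff

-- the summit and its single sub-problem share the name (CONVENTIONS §1), as in every Theorems file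
set_option linter.dupNamespace false

namespace Summit.NavierStokesRegularity.NavierStokesRegularity.Theorems.CoriolisHead

namespace TypeIRate

open Literature.Analysis.FluidPDE

/-! ## §1 Critical forcing: the spiral transport estimate with a logarithm -/

/-- `(ρ/R)^{1/(1+log(ρ/R))} ≤ e` for `0 < R ≤ ρ`. -/
theorem div_rpow_inv_one_add_log_le {R ρ : ℝ} (hR : 0 < R) (hρ : R ≤ ρ) :
    (ρ / R) ^ (1 / (1 + Real.log (ρ / R))) ≤ Real.exp 1 := by
  have hρR : 1 ≤ ρ / R := (one_le_div hR).2 hρ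
  have hL0 : 0 ≤ Real.log (ρ / R) := Real.log_nonneg hρR
  rw [Real.rpow_def_of_pos (by linarith), Real.exp_le_exp, mul_one_div]
  exact (div_le_one (by linarith)).2 (by linarith)

/-- **Spiral transport estimate, critical forcing (log loss).**  Let `a > 0`, `B` skew, `W ∈ C¹(ℝ³; ℝ³)` with
`‖W‖ ≤ m` on the sphere `‖y‖ = R` (`R > 0`), and suppose that on the shell `R ≤ ‖y‖ ≤ ρ` the transport expression
obeys `‖DW·(ay − By) + aW + BW‖ ≤ D/‖y‖² + C/‖y‖` (the second term is CRITICAL).  Then on that shell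
`‖y‖‖W(y)‖ ≤ Rm + D/(aR) + (eC/a)(1 + log(ρ/R))`.  Derived from the subcritical estimate
`norm_mul_norm_le_of_transport` with `δ = 1/(1 + log(ρ/R))`: on the shell `C/‖y‖ ≤ Cρ^δ/‖y‖^{1+δ}`, and
`ρ^δ/(δR^δ) ≤ e(1 + log(ρ/R))`. [folklore] -/
theorem norm_mul_norm_le_of_transport_log {a : ℝ} (ha : 0 < a)
    {B : EuclideanSpace ℝ (Fin 3) →L[ℝ] EuclideanSpace ℝ (Fin 3)} (hB : ∀ x, inner ℝ (B x) x = 0)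
    {W : EuclideanSpace ℝ (Fin 3) → EuclideanSpace ℝ (Fin 3)} (hW : Differentiable ℝ W)
    {R ρ D C m : ℝ} (hR : 0 < R) (hD : 0 ≤ D) (hC : 0 ≤ C)
    (hm : ∀ y : EuclideanSpace ℝ (Fin 3), ‖y‖ = R → ‖W y‖ ≤ m)
    (hG : ∀ y : EuclideanSpace ℝ (Fin 3), R ≤ ‖y‖ → ‖y‖ ≤ ρ →
      ‖fderiv ℝ W y (a • y - B y) + (a • W y + B (W y))‖ ≤ D / ‖y‖ ^ 2 + C / ‖y‖)
    {y : EuclideanSpace ℝ (Fin 3)} (hy1 : R ≤ ‖y‖) (hy2 : ‖y‖ ≤ ρ) :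
    ‖y‖ * ‖W y‖ ≤ R * m + D / (a * R) + Real.exp 1 * C / a * (1 + Real.log (ρ / R)) := by
  have hρ : R ≤ ρ := hy1.trans hy2
  have hρpos : 0 < ρ := hR.trans_le hρ
  have hL0 : 0 ≤ Real.log (ρ / R) := Real.log_nonneg ((one_le_div hR).2 hρ)
  obtain ⟨L, hL⟩ : ∃ L : ℝ, L = Real.log (ρ / R) := ⟨_, rfl⟩
  rw [← hL] at hL0 ⊢
  obtain ⟨δ, hδdef⟩ : ∃ δ : ℝ, δ = 1 / (1 + L) := ⟨_, rfl⟩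
  have hδ : 0 < δ := by rw [hδdef]; positivity
  -- the critical term as a subcritical one with constant `C ρ^δ`
  have hG' : ∀ z : EuclideanSpace ℝ (Fin 3), R ≤ ‖z‖ → ‖z‖ ≤ ρ →
      ‖fderiv ℝ W z (a • z - B z) + (a • W z + B (W z))‖ ≤ D / ‖z‖ ^ 2 + C * ρ ^ δ / ‖z‖ ^ (1 + δ) := by
    intro z hz1 hz2
    have hzpos : 0 < ‖z‖ := hR.trans_le hz1
    refine (hG z hz1 hz2).trans (add_le_add le_rfl ?_)
    rw [div_le_div_iff₀ hzpos (Real.rpow_pos_of_pos hzpos _), Real.rpow_add hzpos, Real.rpow_one]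
    have h2 : ‖z‖ ^ δ ≤ ρ ^ δ := Real.rpow_le_rpow (norm_nonneg _) hz2 hδ.le
    calc C * (‖z‖ * ‖z‖ ^ δ) ≤ C * (‖z‖ * ρ ^ δ) :=
          mul_le_mul_of_nonneg_left (mul_le_mul_of_nonneg_left h2 (norm_nonneg _)) hC
      _ = C * ρ ^ δ * ‖z‖ := by ring
  have hkey := norm_mul_norm_le_of_transport ha hB hW hR hδ hD (by positivity : 0 ≤ C * ρ ^ δ) hm hG'
    hy1 hy2
  -- `C ρ^δ/(a δ R^δ) ≤ (eC/a)(1 + L)`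
  have hratio : ρ ^ δ / R ^ δ ≤ Real.exp 1 := by
    rw [← Real.div_rpow hρpos.le hR.le, hδdef, hL]
    exact div_rpow_inv_one_add_log_le hR hρ
  have hRδ : 0 < R ^ δ := Real.rpow_pos_of_pos hR _
  have e1 : C * ρ ^ δ / (a * δ * R ^ δ) = C / a * (1 + L) * (ρ ^ δ / R ^ δ) := by
    rw [hδdef]
    field_simp
  have hlast : C * ρ ^ δ / (a * δ * R ^ δ) ≤ Real.exp 1 * C / a * (1 + L) := by
    rw [e1]
    calc C / a * (1 + L) * (ρ ^ δ / R ^ δ) ≤ C / a * (1 + L) * Real.exp 1 :=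
          mul_le_mul_of_nonneg_left hratio (by positivity)
      _ = Real.exp 1 * C / a * (1 + L) := by ring
  linarith

/-! ## §2 Absorbing a linear term: the log-loss rate by the shell-maximum bootstrap -/

/-- **Log-loss rate from the transport structure.**  Let `a > 0`, `B` skew, `W ∈ C¹(ℝ³; ℝ³)` bounded (`‖W‖ ≤ m`),
`R > 0`, `0 ≤ κ ≤ aR/2`, and suppose that beyond `R` the transport expression obeys
`‖DW·(ay − By) + aW + BW‖ ≤ κ‖W(y)‖/‖y‖ + D₀/‖y‖² + C/‖y‖`.  Then
`‖y‖‖W(y)‖ ≤ 2(Rm + D₀/(aR) + (eC/a)(1 + log(‖y‖/R)))` beyond `R`.  Proof: maximum `Q` of `‖z‖‖W(z)‖` on the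
shell `R ≤ ‖z‖ ≤ ‖y‖`, `norm_mul_norm_le_of_transport_log` at the maximum point with `D = κQ + D₀`, and
`κ/(aR) ≤ ½` absorbs. [folklore] -/
theorem norm_mul_norm_le_of_transport_linear_log {a : ℝ} (ha : 0 < a)
    {B : EuclideanSpace ℝ (Fin 3) →L[ℝ] EuclideanSpace ℝ (Fin 3)} (hB : ∀ x, inner ℝ (B x) x = 0)
    {W : EuclideanSpace ℝ (Fin 3) → EuclideanSpace ℝ (Fin 3)} (hW : Differentiable ℝ W)
    {R κ D₀ C m : ℝ} (hR : 0 < R) (hκ : 0 ≤ κ) (hκR : κ ≤ a * R / 2) (hD₀ : 0 ≤ D₀)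
    (hC : 0 ≤ C) (hm : ∀ y : EuclideanSpace ℝ (Fin 3), ‖W y‖ ≤ m)
    (hG : ∀ y : EuclideanSpace ℝ (Fin 3), R ≤ ‖y‖ →
      ‖fderiv ℝ W y (a • y - B y) + (a • W y + B (W y))‖ ≤
        κ * ‖W y‖ / ‖y‖ + D₀ / ‖y‖ ^ 2 + C / ‖y‖)
    (y : EuclideanSpace ℝ (Fin 3)) (hy : R ≤ ‖y‖) :
    ‖y‖ * ‖W y‖ ≤ 2 * (R * m + D₀ / (a * R) + Real.exp 1 * C / a * (1 + Real.log (‖y‖ / R))) := by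
  -- the shell `R ≤ ‖z‖ ≤ ‖y‖` and the maximum of `‖z‖ ‖W z‖` on it
  set S : Set (EuclideanSpace ℝ (Fin 3)) := {z | R ≤ ‖z‖ ∧ ‖z‖ ≤ ‖y‖} with hS
  have hSc : IsCompact S := by
    refine (isCompact_closedBall (0 : EuclideanSpace ℝ (Fin 3)) ‖y‖).of_isClosed_subset ?_ ?_
    · exact (isClosed_le continuous_const continuous_norm).inter
        (isClosed_le continuous_norm continuous_const)
    · intro z hz
      exact mem_closedBall_zero_iff.2 hz.2
  have hyS : y ∈ S := ⟨hy, le_rfl⟩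
  have hfc : Continuous fun z : EuclideanSpace ℝ (Fin 3) => ‖z‖ * ‖W z‖ :=
    continuous_norm.mul hW.continuous.norm
  obtain ⟨z₀, hz₀S, hmax⟩ := hSc.exists_isMaxOn ⟨y, hyS⟩ hfc.continuousOn
  set Q : ℝ := ‖z₀‖ * ‖W z₀‖ with hQ
  have hQ0 : 0 ≤ Q := by positivity
  have hQmax : ∀ z ∈ S, ‖z‖ * ‖W z‖ ≤ Q := fun z hz => hmax hz
  have hm0 : 0 ≤ m := (norm_nonneg _).trans (hm 0)
  have hL0 : 0 ≤ Real.log (‖y‖ / R) := Real.log_nonneg ((one_le_div hR).2 hy)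
  -- on the shell the linear term is a `1/‖z‖²` forcing
  have hG' : ∀ z : EuclideanSpace ℝ (Fin 3), R ≤ ‖z‖ → ‖z‖ ≤ ‖y‖ →
      ‖fderiv ℝ W z (a • z - B z) + (a • W z + B (W z))‖ ≤ (κ * Q + D₀) / ‖z‖ ^ 2 + C / ‖z‖ := by
    intro z hz1 hz2
    have hzpos : 0 < ‖z‖ := hR.trans_le hz1
    have h1 : κ * ‖W z‖ / ‖z‖ ≤ κ * Q / ‖z‖ ^ 2 := by
      rw [div_le_div_iff₀ hzpos (pow_pos hzpos 2)]
      have h := mul_le_mul_of_nonneg_left (hQmax z ⟨hz1, hz2⟩) hκ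
      nlinarith
    calc ‖fderiv ℝ W z (a • z - B z) + (a • W z + B (W z))‖
        ≤ κ * ‖W z‖ / ‖z‖ + D₀ / ‖z‖ ^ 2 + C / ‖z‖ := hG z hz1
      _ ≤ κ * Q / ‖z‖ ^ 2 + D₀ / ‖z‖ ^ 2 + C / ‖z‖ := by linarith
      _ = (κ * Q + D₀) / ‖z‖ ^ 2 + C / ‖z‖ := by rw [add_div]
  -- the transport estimate at the maximum point
  have hkey := norm_mul_norm_le_of_transport_log ha hB hW hR (by positivity : 0 ≤ κ * Q + D₀) hC
    (fun z _ => hm z) hG' hz₀S.1 hz₀S.2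
  -- absorb
  have habs : (κ * Q + D₀) / (a * R) ≤ Q / 2 + D₀ / (a * R) := by
    rw [add_div]
    have h1 : κ * Q / (a * R) ≤ Q / 2 := by
      rw [div_le_div_iff₀ (by positivity) two_pos]
      have := mul_le_mul_of_nonneg_right hκR hQ0
      nlinarith
    linarith
  have hE : 0 ≤ Real.exp 1 * C / a * (1 + Real.log (‖y‖ / R)) := by positivity
  have hQle : Q ≤ 2 * (R * m + D₀ / (a * R) + Real.exp 1 * C / a * (1 + Real.log (‖y‖ / R))) := by
    have : Q ≤ R * m + (Q / 2 + D₀ / (a * R)) + Real.exp 1 * C / a * (1 + Real.log (‖y‖ / R)) := by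
      calc Q = ‖z₀‖ * ‖W z₀‖ := hQ
        _ ≤ R * m + (κ * Q + D₀) / (a * R) + Real.exp 1 * C / a * (1 + Real.log (‖y‖ / R)) := hkey
        _ ≤ R * m + (Q / 2 + D₀ / (a * R)) + Real.exp 1 * C / a * (1 + Real.log (‖y‖ / R)) := by
            linarith
    linarith
  exact (hQmax y hyS).trans hQle

/-- **The same with a shifted centre** `c` (spiral characteristics of `V(y) = a(y − c) − B(y − c)`): if beyond
`‖y − c‖ ≥ R` one has `‖DW·(a(y−c) − B(y−c)) + aW + BW‖ ≤ κ‖W(y)‖/‖y−c‖ + D₀/‖y−c‖² + C/‖y−c‖`, then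
`‖y − c‖‖W(y)‖ ≤ 2(Rm + D₀/(aR) + (eC/a)(1 + log(‖y − c‖/R)))` there. [folklore] -/
theorem norm_mul_norm_le_of_transport_linear_log_shift {a : ℝ} (ha : 0 < a)
    {B : EuclideanSpace ℝ (Fin 3) →L[ℝ] EuclideanSpace ℝ (Fin 3)} (hB : ∀ x, inner ℝ (B x) x = 0)
    {W : EuclideanSpace ℝ (Fin 3) → EuclideanSpace ℝ (Fin 3)} (hW : Differentiable ℝ W)
    (c : EuclideanSpace ℝ (Fin 3))
    {R κ D₀ C m : ℝ} (hR : 0 < R) (hκ : 0 ≤ κ) (hκR : κ ≤ a * R / 2) (hD₀ : 0 ≤ D₀)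
    (hC : 0 ≤ C) (hm : ∀ y : EuclideanSpace ℝ (Fin 3), ‖W y‖ ≤ m)
    (hG : ∀ y : EuclideanSpace ℝ (Fin 3), R ≤ ‖y - c‖ →
      ‖fderiv ℝ W y (a • (y - c) - B (y - c)) + (a • W y + B (W y))‖ ≤
        κ * ‖W y‖ / ‖y - c‖ + D₀ / ‖y - c‖ ^ 2 + C / ‖y - c‖)
    (y : EuclideanSpace ℝ (Fin 3)) (hy : R ≤ ‖y - c‖) :
    ‖y - c‖ * ‖W y‖ ≤
      2 * (R * m + D₀ / (a * R) + Real.exp 1 * C / a * (1 + Real.log (‖y - c‖ / R))) := by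
  set W' : EuclideanSpace ℝ (Fin 3) → EuclideanSpace ℝ (Fin 3) := fun z => W (z + c) with hW'
  have hW'd : Differentiable ℝ W' := hW.comp (differentiable_id.add_const c)
  have hfd : ∀ z, fderiv ℝ W' z = fderiv ℝ W (z + c) := fun z => by
    rw [hW']
    exact fderiv_comp_add_right c
  have hm' : ∀ z : EuclideanSpace ℝ (Fin 3), ‖W' z‖ ≤ m := fun z => hm (z + c)
  have hG'' : ∀ z : EuclideanSpace ℝ (Fin 3), R ≤ ‖z‖ →
      ‖fderiv ℝ W' z (a • z - B z) + (a • W' z + B (W' z))‖ ≤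
        κ * ‖W' z‖ / ‖z‖ + D₀ / ‖z‖ ^ 2 + C / ‖z‖ := by
    intro z hz
    have h := hG (z + c) (by rwa [add_sub_cancel_right])
    rw [add_sub_cancel_right] at h
    rw [hfd]
    exact h
  have h := norm_mul_norm_le_of_transport_linear_log ha hB hW'd hR hκ hκR hD₀ hC hm' hG'' (y - c) hy
  simpa only [hW', sub_add_cancel] using h

end TypeIRate

end Summit.NavierStokesRegularity.NavierStokesRegularity.Theorems.CoriolisHead

end
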